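import Mathlib.Analysis.InnerProductSpace.Projection.Reflection
import Mathlib.Analysis.Calculus.Gradient.Basic
import Mathlib.Analysis.Calculus.FDeriv.Equiv
import Mathlib.Analysis.InnerProductSpace.PiL2
import HarnessLib

/-!
# Crux `SelfMixingDichotomy.CoherentScaleExclusion` (stmt-NavierStokesRegularity-1423), line `registered`:
# stub SW2 `stub_inner_gradient_eq_zero_of_reflectionInvariant` — reflection symmetry kills the
# normal derivative

Support file (`--supports stmt-NavierStokesRegularity-1423`) of the line lead c3 for the amplitude-free
coherence package (sphere-tangential drifts never stir radial blobs). The calculus step: if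
`f : ℝ³ → ℝ` is differentiable at `x`, invariant under the reflection `R` in the plane `(ℝ v)ᗮ`, and `x`
lies in that plane (`⟪v, x⟫ = 0`), then `⟪v, ∇f(x)⟫ = 0`. Indeed `R x = x` and `R v = -v`, so by the
chain rule `Df(x)[v] = D(f ∘ R)(x)[v] = Df(R x)[R v] = Df(x)[-v] = -Df(x)[v]`, whence `Df(x)[v] = 0`,
and `⟪v, ∇f(x)⟫ = Df(x)[v]` (Riesz). Only Mathlib is used.
-/

noncomputable section

open InnerProductSpace

-- `Summit = Problem` for this summit; the tree lakefile sets `weak.linter.dupNamespace = false`.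
set_option linter.dupNamespace false

namespace Summit.NavierStokesRegularity.NavierStokesRegularity.Theorems

/-- **SW2 — reflection symmetry kills the tangential derivative** (registered sub-goal
`stub_inner_gradient_eq_zero_of_reflectionInvariant` of the crux `CoherentScaleExclusion`, line
`registered`, lead c3). If `f : ℝ³ → ℝ` is differentiable at `x` and invariant under the reflection in
the plane `(ℝ v)ᗮ`, and `x` lies in that plane (`⟪v, x⟫ = 0`), then `⟪v, ∇f(x)⟫ = 0`:
`Df(x)[v] = Df(Rx)[Rv] = Df(x)[−v]` (`Submodule.reflection_mem_subspace_eq_self`,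
`Submodule.reflection_orthogonalComplement_singleton_eq_neg`, `ContinuousLinearEquiv.comp_right_fderiv`,
`inner_gradient_left`). -/
theorem stub_inner_gradient_eq_zero_of_reflectionInvariant :
    ∀ (f : EuclideanSpace ℝ (Fin 3) → ℝ) (v x : EuclideanSpace ℝ (Fin 3)),
      DifferentiableAt ℝ f x →
      (∀ y, f ((Submodule.span ℝ {v})ᗮ.reflection y) = f y) →
      inner ℝ v x = 0 →
      inner ℝ v (gradient f x) = 0 := by
  intro f v x _hf hsymm hvx
  set R : EuclideanSpace ℝ (Fin 3) ≃ₗᵢ[ℝ] EuclideanSpace ℝ (Fin 3) :=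
    (Submodule.span ℝ {v})ᗮ.reflection
  -- `x` lies in the mirror plane, so it is fixed; `v` is normal to it, so it is flipped.
  have hx : R x = x :=
    Submodule.reflection_mem_subspace_eq_self
      (Submodule.mem_orthogonal_singleton_iff_inner_right.mpr hvx)
  have hv : R v = -v := Submodule.reflection_orthogonalComplement_singleton_eq_neg v
  -- chain rule for `f ∘ R = f`
  have hcomp : f ∘ ⇑R = f := funext hsymm
  have hchain : fderiv ℝ (f ∘ ⇑R) x =
      (fderiv ℝ f (R x)).comp
        ((R.toContinuousLinearEquiv : EuclideanSpace ℝ (Fin 3) ≃L[ℝ] EuclideanSpace ℝ (Fin 3)) :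
          EuclideanSpace ℝ (Fin 3) →L[ℝ] EuclideanSpace ℝ (Fin 3)) :=
    R.toContinuousLinearEquiv.comp_right_fderiv
  have hflip : fderiv ℝ f x v = -fderiv ℝ f x v := by
    conv_lhs => rw [← hcomp, hchain]
    simp [hx, hv]
  have hzero : fderiv ℝ f x v = 0 := by linarith
  rw [real_inner_comm, inner_gradient_left, hzero]

end Summit.NavierStokesRegularity.NavierStokesRegularity.Theorems

end
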